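import Literature.AlgebraicGeometry.Frobenioids.PullbackLinear
import Mathlib.Algebra.Group.Subgroup.Ker
import HarnessLib

/-!
# Frobenioids I, Proposition 1.12 (Endomorphisms)

Mochizuki, *The geometry of Frobenioids I: the general theory*, Kyushu J. Math. **62** (2008)
293–400, §1, Proposition 1.12 and its proof, kurims text p. 39
[cite: MochizukiFrdI2008, Prop. 1.12]. Standing data: `C → F_Φ` a Frobenioid (`hF`), `A ∈ Ob(C)`.

> "(i) We have natural exact sequences of monoids `1 → O^×(A) → Aut_C(A) → Aut_D(A_D)`,
> `1 → O^▷(A) → End_C(A) → N_{≥1} × End_D(A_D)` — where the second arrow in each sequence is the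
> natural inclusion; the third arrow of the first sequence is determined by the natural projection
> functor to `D`; the third arrow of the second sequence is determined by the Frobenius degree and
> the natural projection functor to `D`. If, moreover, `A` is Aut-ample (respectively, End-ample;
> quasi-Frobenius-trivial), then the map `Aut_C(A) → Aut_D(A_D)` (respectively,
> `End_C(A) → End_D(A_D)`; `End_C(A) → N_{≥1}`) is surjective.
> (ii) An endomorphism of `A` is a sub-automorphism [cf. §0] if and only if it is an isometric
> linear endomorphism that projects to a sub-automorphism of `D`.
> (iii) A sub-automorphism of `A` is an automorphism if and only if it is a base-isomorphism.
> (iv) Suppose that `A` is `Aut^sub`-ample. Then `A` is Aut-saturated [cf. §0] if and only if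
> `A_D` is."

What is PROVED here: (i) completely (kernels of the two homomorphisms and the three
surjectivities); of (ii) the direction "isometric linear endomorphism over a sub-automorphism ⇒
sub-automorphism" (the printed sufficiency argument: Def. 1.3 (i)(c), Prop. 1.11 (iii),
Prop. 1.4 (iii)) and, of the necessity, "sub-automorphism ⇒ linear, and projects to a
sub-automorphism"; of (iii) the direction "automorphism ⇒ base-isomorphism".

REFEREE NOTE (recorded with care; nothing here asserts an error in the paper beyond what is
kernel-checked). The remaining printed claims — (ii) "sub-automorphism ⇒ isometric",
(iii) "base-isomorphic sub-automorphism ⇒ automorphism" and (iv) — are typed below as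
`Prop`-valued statements (`subAutomorphism_isIsometry_statement`, …) and NOT proved. The printed
justification ("immediate from Remark 1.1.1") computes, for `φ ∘ β = α ∘ φ` with `β ∈ Aut_C(B)`,
`Base(β)^* Div(φ) = Base(φ)^* Div(α) + Div(φ)`, and concludes `Div(α) = 0`; this needs
`Base(β)^* Div(φ) = Div(φ)`, i.e. that automorphisms of the base act trivially (or at least
non-increasingly) on zero divisors. In an elementary Frobenioid `F_Φ` (a Frobenioid by Prop. 1.5)
over a one-object base `D` with `Aut = ℤ` acting on `Φ(pt) = (ℚ_{≥0}, +)` by powers of `2`, the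
endomorphism `α = (b, 1, 1)` satisfies `φ ∘ β = α ∘ φ` with `φ = (id, 1, 1)`, `β = (b, 0, 1)`, so
`α` is a base-isomorphic sub-automorphism with `Div(α) = 1 ≠ 0`, not an automorphism; this
shows the three claims need an extra hypothesis (e.g. of non-dilating flavour); the example is
kernel-checked in the companion file `EndomorphismsCounterexample.lean`. The three claims are
therefore kept as `Prop`-valued statements here, exactly as printed, and are NOT asserted.
No statement of the paper is strengthened; the unproved ones are not weakened either.
-/

namespace Literature.AlgebraicGeometry.Frobenioids

open CategoryTheory Opposite

universe w v v' u u'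

namespace PreFrobenioid

variable {D : Type u} [Category.{v} D] {Φ : Dᵒᵖ ⥤ CommMonCat.{w}}
  {C : Type u'} [Category.{v'} C] (F : C ⥤ ElemFrobenioid Φ)

/-! ### Proposition 1.12 (i) -/

/-- The third arrow of the second sequence of Prop. 1.12 (i): `End_C(A) → N_{≥1} × End_D(A_D)`,
`α ↦ (deg_Fr(α), Base(α))` (a homomorphism by Remark 1.1.1).
[cite: MochizukiFrdI2008, Prop. 1.12(i) p.39] -/
def degBaseHom (A : C) : End A →* ℕ+ × End (baseObj F A) where
  toFun α := (degFr F α, Base F α)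
  map_one' := Prod.ext (degFr_id F A) (base_id F A)
  map_mul' α β := by
    refine Prod.ext ?_ ?_
    · show degFr F (β ≫ α) = degFr F α * degFr F β
      rw [degFr_comp, mul_comm]
    · show Base F (β ≫ α) = Base F β ≫ Base F α
      rw [base_comp]

/-- **Prop. 1.12 (i)**, second sequence: `1 → O^▷(A) → End_C(A) → N_{≥1} × End_D(A_D)` is exact,
i.e. `O^▷(A)` is the kernel of `α ↦ (deg_Fr α, Base α)` ("immediate from the definitions").
[cite: MochizukiFrdI2008, Prop. 1.12(i) p.39] -/
theorem mker_degBaseHom (A : C) : MonoidHom.mker (degBaseHom F A) = endSubmonoid F A := by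
  ext α
  simp only [MonoidHom.mem_mker, degBaseHom, MonoidHom.coe_mk, OneHom.coe_mk, Prod.mk_eq_one]
  exact ⟨fun h => ⟨h.2, h.1⟩, fun h => ⟨h.2, h.1⟩⟩

/-- **Prop. 1.12 (i)**, first sequence: `1 → O^×(A) → Aut_C(A) → Aut_D(A_D)` is exact, i.e.
`O^×(A)` is the kernel of `Aut_C(A) → Aut_D(A_D)` (automorphisms are linear, Remark 1.1.1).
[cite: MochizukiFrdI2008, Prop. 1.12(i) p.39] -/
theorem ker_mapAut (A : C) : (Functor.mapAut A (baseFunctor F)).ker = unitsSubgroup F A := by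
  ext α
  rw [MonoidHom.mem_ker]
  constructor
  · intro h
    exact ⟨congrArg Iso.hom h, isLinear_of_isIso F α.hom⟩
  · intro h
    exact Iso.ext h.1

/-- **Prop. 1.12 (i)**: if `A` is `Aut`-ample then `Aut_C(A) → Aut_D(A_D)` is surjective.
[cite: MochizukiFrdI2008, Prop. 1.12(i) p.39] -/
theorem mapAut_surjective_of_isAutAmple {A : C} (h : IsAutAmple F A) :
    Function.Surjective (Functor.mapAut A (baseFunctor F)) := h

/-- **Prop. 1.12 (i)**: if `A` is `End`-ample then `End_C(A) → End_D(A_D)` is surjective.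
[cite: MochizukiFrdI2008, Prop. 1.12(i) p.39] -/
theorem mapEnd_surjective_of_isEndAmple {A : C} (h : IsEndAmple F A) :
    Function.Surjective (Functor.mapEnd A (baseFunctor F)) := fun f => h f

/-- **Prop. 1.12 (i)**: if `A` is quasi-Frobenius-trivial then `End_C(A) → N_{≥1}`,
`α ↦ deg_Fr(α)`, is surjective. [cite: MochizukiFrdI2008, Prop. 1.12(i) p.39] -/
theorem degFr_surjective_of_isQuasiFrobeniusTrivial {A : C} (h : IsQuasiFrobeniusTrivial F A) :
    Function.Surjective fun α : End A => degFr F α := fun n => by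
  obtain ⟨φ, -, hφ⟩ := h n
  exact ⟨φ, hφ⟩

/-! ### Proposition 1.12 (ii): the proved parts -/

variable {F}

/-- **Prop. 1.12 (ii)**, necessity, first part: a sub-automorphism of `A` is linear
(Remark 1.1.1: `deg_Fr(φ) · deg_Fr(β) = deg_Fr(α) · deg_Fr(φ)` with `β` an isomorphism).
[cite: MochizukiFrdI2008, Prop. 1.12(ii) p.39] -/
theorem IsSubAutomorphism.isLinear {A : C} {α : A ⟶ A} (h : IsSubAutomorphism α) : IsLinear F α := by
  obtain ⟨B, φ, β, hsq⟩ := h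
  have hd := congrArg (degFr F) hsq
  rw [degFr_comp, degFr_comp, isLinear_of_isIso F β.hom, one_mul] at hd
  show degFr F α = 1
  have : degFr F φ * degFr F α = degFr F φ * 1 := by rw [mul_one]; exact hd.symm
  exact mul_left_cancel this

/-- **Prop. 1.12 (ii)**, necessity, second part: a sub-automorphism of `A` "projects to a
sub-automorphism of `D`" (apply the projection functor to `φ ∘ β = α ∘ φ`).
[cite: MochizukiFrdI2008, Prop. 1.12(ii) p.39] -/
theorem IsSubAutomorphism.base {A : C} {α : A ⟶ A} (h : IsSubAutomorphism α) :
    IsSubAutomorphism (Base F α) := by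
  obtain ⟨B, φ, β, hsq⟩ := h
  refine ⟨baseObj F B, Base F φ, (baseFunctor F).mapIso β, ?_⟩
  show Base F β.hom ≫ Base F φ = Base F φ ≫ Base F α
  rw [← base_comp, hsq, base_comp]

/-- **Prop. 1.12 (ii)**, sufficiency: an isometric linear endomorphism `α` of `A` projecting to a
sub-automorphism of `D` is a sub-automorphism of `A` (realise the witness `f : B₀ → A_D` by a
pull-back morphism `φ : B → A`, Def. 1.3 (i)(c); lift the conjugated automorphism by
Prop. 1.11 (iii); the lift is an LB-invertible pre-step, hence an isomorphism, Prop. 1.4 (iii)).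
[cite: MochizukiFrdI2008, Prop. 1.12(ii) p.39] -/
theorem isSubAutomorphism_of_isIsometry_isLinear (hF : IsFrobenioid F) {A : C} {α : A ⟶ A}
    (hiso : IsIsometry F α) (hlin : IsLinear F α) (hb : IsSubAutomorphism (Base F α)) :
    IsSubAutomorphism α := by
  obtain ⟨B₀, f, b, hsq⟩ := hb
  obtain ⟨B, φ, i, hφ, hφb⟩ := exists_isPullbackMorphism_over hF A f
  -- the conjugated automorphism `β_D := i ≫ b ≫ i⁻¹` of `B_D`
  obtain ⟨β, ⟨hβb, hβ⟩, -⟩ := existsUnique_endo_lift hφ α (i.hom ≫ b.hom ≫ i.inv) (by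
    simp only [hφb, Category.assoc, Iso.inv_hom_id_assoc, hsq])
  obtain ⟨⟨-, hφiso⟩, hφlin⟩ := hF.iv_b φ hφ
  -- `β` is an LB-invertible pre-step, hence an isomorphism
  have hβlin : IsLinear F β := by
    have hd := congrArg (degFr F) hβ
    rw [degFr_comp, degFr_comp, show degFr F α = 1 from hlin, show degFr F φ = 1 from hφlin,
      mul_one, mul_one] at hd
    exact hd.symm
  have hβiso : IsIsometry F β := by
    have hd := congrArg (Div F) hβ
    rw [div_comp, div_comp, show Div F α = 1 from hiso, map_one, one_mul, show Div F φ = 1 from hφiso,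
      one_pow, map_one, one_mul, show degFr F φ = 1 from hφlin, PNat.one_coe, pow_one] at hd
    exact hd.symm
  have hβbi : IsBaseIso F β := by
    show IsIso (Base F β); rw [hβb]; infer_instance
  haveI : IsIso β := isIso_of_isLBInvertible_of_isPreStep F hF β
    ⟨isCoAngular_endo F hF β, hβiso⟩ ⟨hβlin, hβbi⟩
  exact ⟨B, φ, asIso β, hβ.symm⟩

/-! ### Proposition 1.12 (iii): the proved part -/

/-- **Prop. 1.12 (iii)**, necessity: a sub-automorphism that is an automorphism is a
base-isomorphism (functors preserve isomorphisms). [cite: MochizukiFrdI2008, Prop. 1.12(iii) p.39] -/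
theorem isBaseIso_of_isSubAutomorphism_of_isIso {A : C} (α : A ⟶ A) [IsIso α] : IsBaseIso F α :=
  isBaseIso_of_isIso F α

/-! ### Proposition 1.12 (ii)–(iv): the printed statements (see the REFEREE NOTE) -/

variable (F)

/-- **Prop. 1.12 (ii)**, the printed necessity "a sub-automorphism of `A` is isometric", as a
statement (NOT proved here; see the module docstring's REFEREE NOTE for why the printed argument
"immediate from Remark 1.1.1" appears to need an extra hypothesis).
[cite: MochizukiFrdI2008, Prop. 1.12(ii) p.39] -/
def SubAutomorphismIsIsometryStatement (A : C) : Prop :=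
  ∀ α : A ⟶ A, IsSubAutomorphism α → IsIsometry F α

/-- **Prop. 1.12 (ii)** as printed: "An endomorphism of `A` is a sub-automorphism if and only if it
is an isometric linear endomorphism that projects to a sub-automorphism of `D`" (statement; the
directions proved in this file are `IsSubAutomorphism.isLinear`, `IsSubAutomorphism.base`,
`isSubAutomorphism_of_isIsometry_isLinear`). [cite: MochizukiFrdI2008, Prop. 1.12(ii) p.39] -/
def EndoIsSubAutomorphismIffStatement (A : C) : Prop :=
  ∀ α : A ⟶ A, IsSubAutomorphism α ↔ IsIsometry F α ∧ IsLinear F α ∧ IsSubAutomorphism (Base F α)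

/-- **Prop. 1.12 (iii)** as printed: "A sub-automorphism of `A` is an automorphism if and only if
it is a base-isomorphism" (statement; the direction `⇒` is
`isBaseIso_of_isSubAutomorphism_of_isIso`; `⇐` rests on (ii), see the REFEREE NOTE).
[cite: MochizukiFrdI2008, Prop. 1.12(iii) p.39] -/
def SubAutomorphismIsIsoIffStatement (A : C) : Prop :=
  ∀ α : A ⟶ A, IsSubAutomorphism α → (IsIso α ↔ IsBaseIso F α)

/-- **Prop. 1.12 (iv)** as printed: "Suppose that `A` is `Aut^sub`-ample. Then `A` is
`Aut`-saturated if and only if `A_D` is" (statement; "follows formally from assertions (ii),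
(iii)" — see the REFEREE NOTE). [cite: MochizukiFrdI2008, Prop. 1.12(iv) p.39] -/
def AutSaturatedIffStatement (A : C) : Prop :=
  IsAutSubAmple F A → (IsAutSaturatedObj A ↔ IsAutSaturatedObj (baseObj F A))

variable {F}

/-- The dependency noted in the text: (ii) [necessity] and (iii) [sufficiency] together give the
direction "`A_D` `Aut`-saturated ⇒ `A` `Aut`-saturated" of (iv), for ANY object `A`
("assertion (iv) follows formally from assertions (ii), (iii) and the definitions").
[cite: MochizukiFrdI2008, Prop. 1.12(iv) p.39] -/
theorem isAutSaturatedObj_of_base (A : C) (hiii : SubAutomorphismIsIsoIffStatement F A)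
    (hD : IsAutSaturatedObj (baseObj F A)) : IsAutSaturatedObj A := by
  intro α hα
  have hb : IsIso (Base F α) := hD (Base F α) (IsSubAutomorphism.base hα)
  exact (hiii α hα).mpr hb

/-- The other direction of (iv), "`A` `Aut`-saturated and `Aut^sub`-ample ⇒ `A_D` `Aut`-saturated",
holds unconditionally (lift a sub-automorphism of `A_D` to a sub-automorphism of `A`, which is then
an automorphism, and project). [cite: MochizukiFrdI2008, Prop. 1.12(iv) p.39] -/
theorem isAutSaturatedObj_base (A : C) (hamp : IsAutSubAmple F A) (hA : IsAutSaturatedObj A) :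
    IsAutSaturatedObj (baseObj F A) := by
  intro f hf
  obtain ⟨α, hα, hαf⟩ := hamp f hf
  haveI : IsIso α := hA α hα
  rw [← hαf]
  exact isBaseIso_of_isIso F α

/-! ### Proposition 1.12 (ii)–(iv) under the hypothesis actually used by the printed proof -/

variable (F)

/-- Hypothesis (H) — *automorphisms act trivially on zero divisors*: for every automorphism `β`
of an object `B` and every arrow `φ : B → A`, `Base(β)^* Div(φ) = Div(φ)` (equivalently, by
Remark 1.1.1, `Div(φ ∘ β) = Div(φ)`). This is precisely the equality the printed proof of
Prop. 1.12 (ii) ("immediate from Remark 1.1.1") uses; it fails in the example of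
`EndomorphismsCounterexample.lean` and holds, e.g., whenever automorphisms of objects of `D` pull
back zero divisors identically. Recorded as an EXPLICIT extra hypothesis (referee item), not as a
claim about the author's intention. [cite: MochizukiFrdI2008, Prop. 1.12(ii) p.39] -/
def AutFixesDiv : Prop :=
  ∀ ⦃B A : C⦄ (β : B ≅ B) (φ : B ⟶ A), pull Φ (Base F β.hom) (Div F φ) = Div F φ

variable {F}

/-- Under (H), the printed argument for Prop. 1.12 (ii) goes through: a sub-automorphism is
isometric (`Base(β)^*Div φ = Base(φ)^*Div α + Div φ` with the left side equal to `Div φ`, then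
cancel and use injectivity of `Base(φ)^*`). [cite: MochizukiFrdI2008, Prop. 1.12(ii) p.39] -/
theorem IsSubAutomorphism.isIsometry_of_autFixesDiv (hP : IsPreFrobenioid Φ F) (hH : AutFixesDiv F)
    {A : C} {α : A ⟶ A} (h : IsSubAutomorphism α) : IsIsometry F α := by
  have hlin : IsLinear F α := IsSubAutomorphism.isLinear h
  obtain ⟨B, φ, β, hsq⟩ := h
  have hd := congrArg (Div F) hsq
  rw [div_comp, div_comp, isIsometry_of_isIso F hP β.hom, one_pow, mul_one, hH β φ,
    show degFr F α = 1 from hlin, PNat.one_coe, pow_one] at hd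
  -- `Div φ = Base(φ)^* Div α · Div φ`
  haveI : IsCancelMul (Φ.obj (op (baseObj F B))) :=
    isIntegral_iff_isCancelMul.mp (hP.isDivisorial _).isPreDivisorial.isIntegral
  have h1 : 1 * Div F φ = pull Φ (Base F φ) (Div F α) * Div F φ := by rw [one_mul]; exact hd
  have h2 : pull Φ (Base F φ) (Div F α) = 1 := (mul_right_cancel h1).symm
  exact (hP.isMonoidOn.isCharInjective (Base F φ)).1 (by rw [h2, map_one])

/-- Under (H): the printed necessity of Prop. 1.12 (ii). [cite: MochizukiFrdI2008, Prop. 1.12(ii) p.39] -/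
theorem subAutomorphismIsIsometryStatement_of_autFixesDiv (hP : IsPreFrobenioid Φ F)
    (hH : AutFixesDiv F) (A : C) : SubAutomorphismIsIsometryStatement F A :=
  fun _ h => IsSubAutomorphism.isIsometry_of_autFixesDiv hP hH h

/-- Under (H): Prop. 1.12 (ii) as printed. [cite: MochizukiFrdI2008, Prop. 1.12(ii) p.39] -/
theorem endoIsSubAutomorphismIffStatement_of_autFixesDiv (hF : IsFrobenioid F) (hH : AutFixesDiv F)
    (A : C) : EndoIsSubAutomorphismIffStatement F A := fun _ =>
  ⟨fun h => ⟨IsSubAutomorphism.isIsometry_of_autFixesDiv hF.isPreFrobenioid hH h,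
      IsSubAutomorphism.isLinear h, IsSubAutomorphism.base h⟩,
    fun h => isSubAutomorphism_of_isIsometry_isLinear hF h.1 h.2.1 h.2.2⟩

/-- Under (H): Prop. 1.12 (iii) as printed (an isometric, linear, base-isomorphic endomorphism is an
LB-invertible pre-step — endomorphisms are co-angular — hence an isomorphism, Prop. 1.4 (iii)).
[cite: MochizukiFrdI2008, Prop. 1.12(iii) p.39] -/
theorem subAutomorphismIsIsoIffStatement_of_autFixesDiv (hF : IsFrobenioid F) (hH : AutFixesDiv F)
    (A : C) : SubAutomorphismIsIsoIffStatement F A := fun α h =>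
  ⟨fun _ => isBaseIso_of_isIso F α, fun hb =>
    isIso_of_isLBInvertible_of_isPreStep F hF α
      ⟨isCoAngular_endo F hF α, IsSubAutomorphism.isIsometry_of_autFixesDiv hF.isPreFrobenioid hH h⟩
      ⟨IsSubAutomorphism.isLinear h, hb⟩⟩

/-- Under (H): Prop. 1.12 (iv) as printed. [cite: MochizukiFrdI2008, Prop. 1.12(iv) p.39] -/
theorem autSaturatedIffStatement_of_autFixesDiv (hF : IsFrobenioid F) (hH : AutFixesDiv F) (A : C) :
    AutSaturatedIffStatement F A := fun hamp =>
  ⟨isAutSaturatedObj_base A hamp,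
    isAutSaturatedObj_of_base A (subAutomorphismIsIsoIffStatement_of_autFixesDiv hF hH A)⟩

end PreFrobenioid

end Literature.AlgebraicGeometry.Frobenioids
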